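import Mathlib
import HarnessLib
import Summits.Ventures.LatticeQCDFlow.Scaling.IdentityFlowSlopeVolumeLimit
import Summits.Ventures.LatticeQCDFlow.Scaling.U1IdentityFlowVolumeLaw

/-!
# LatticeQCDFlow / Scaling — the untrained 2-d U(1) sampler on the diagonal `β√V = c`, in the
# cell's closed-form vocabulary: `ESS_V → e^{−c²/2}`, ceiling `→ e^{−c²/8}`, `acc_V → erfc(|c|/(2√2))`

HONEST FRAMING: exact (Metropolis-corrected) sampling algorithms for lattice gauge theory;
figures of merit are autocorrelation/cost numbers at stated couplings and volumes; no
continuum-physics claim.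

Venture `LatticeQCDFlow` (cell pub-lqcd), topic `Scaling`; FANOUT row 3 (`s0-u1-a`, S0-B
implementation A, GEN-19).  NEW WORK of the cell (dictionary + corollaries); NO definition is
introduced; nothing is cited.  Parents (in the tree): row 3's `Scaling/IdentityFlowSlopeVolumeLimit`
(the U(1) diagonal profile in the product-of-Haar-probabilities form), `Scaling/CumulantDiagonalLimit`
(ESS and ceiling on the diagonal, transitively) and GEN-12's `Scaling/U1IdentityFlowVolumeLaw`
(`ESS_V = (I₀(β)²/I₀(2β))^V`, `(8/9)·ESS_V ≤ acc_V ≤ (I₀(β/2)²/I₀(β))^V`, acceptance written with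
the densities `e^{β cos θ}/Z(β)` and `1/(2π)` against Lebesgue measure on `(0, 2π]^V`).

## Content (all `[ours]`)

* `u1Haar_pi_eq_smul_pi` — `⊗(2π)⁻¹Leb|(0,2π] = (2π)^{−V}·Leb^{⊗V}` (the normalisation bridge);
  `mgf_cos_u1Haar_eq_besselI` — `∫ e^{t cos θ} (2π)⁻¹dθ = I₀(t)`;
* **`u1IdentityFlow_meanAccept_eq_tilt`** — THE DICTIONARY: GEN-12's acceptance
  `∫∫ min(P(x)Q(x′), P(x′)Q(x)) dLeb^{⊗V} dLeb^{⊗V}` EQUALS the tilt-family functional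
  `(∫∫ min(e^{βT}, e^{βT′}) dHaar^{⊗V} dHaar^{⊗V}) / ∫ e^{βT} dHaar^{⊗V}` of
  `Scaling/TiltAcceptanceJensenFloor` / `IdentityFlowAcceptanceDiagonalLimit`, `T = Σᵢ cos θᵢ`;
* **`u1IdentityFlow_essFrac_diag_tendsto`** — `(I₀(c/√V)²/I₀(2c/√V))^V → e^{−c²/2}`;
  **`u1IdentityFlow_ceiling_diag_tendsto`** — `(I₀(c/(2√V))²/I₀(c/√V))^V → e^{−c²/8}`;
  **`u1IdentityFlow_meanAccept_diag_tendsto`** — GEN-12's `acc_V` at `β = c/√V` (`c ≠ 0`)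
  `→ (2/√π)∫_{|c|/(2√2)}^∞ e^{−u²}du = erfc(|c|/(2√2))`.

Reading (value-free): along `β√V = c` the three figures of merit of the untrained U(1) sampler
converge to those of the log-normal weight model with `s = c²/2` — `e^{−s}`, `e^{−s/4}`,
`erfc(√s/2)` — consistent with GEN-12's sandwich in the limit (`(8/9)e^{−s} ≤ erfc(√s/2) ≤ e^{−s/4}`).
NOT CLAIMED: the torus; any value at the cell's `(β, L)`; nothing re-scored.
-/

noncomputable section

namespace Summit.Ventures.LatticeQCDFlow.Theory2

open MeasureTheory ProbabilityTheory Filter Finset Real Set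
open scoped Topology
open Summit.Ventures.LatticeQCDFlow.Scoring Literature.Analysis.FunctionSpaces

/-! ## §1 Normalisation bridge and the one-angle transform -/

section Bridge

variable {ι : Type*} [Fintype ι]

/-- `⊗ᵢ (2π)⁻¹·Leb|(0,2π] = (2π)^{−V} · Leb^{⊗V}` on `(0, 2π]^V`. [folklore] -/
theorem u1Haar_pi_eq_smul_pi :
    (Measure.pi fun _ : ι => (ENNReal.ofReal (2 * π))⁻¹ • volume.restrict (Ioc (0 : ℝ) (2 * π)))
      = ENNReal.ofReal ((1 / (2 * π)) ^ Fintype.card ι)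
        • Measure.pi (fun _ : ι => volume.restrict (Ioc (0 : ℝ) (2 * π))) := by
  haveI : IsProbabilityMeasure ((ENNReal.ofReal (2 * π))⁻¹ • volume.restrict (Ioc (0 : ℝ) (2 * π))) :=
    ⟨by rw [Measure.smul_apply, Measure.restrict_apply_univ, Real.volume_Ioc, sub_zero, smul_eq_mul,
      ENNReal.inv_mul_cancel (ENNReal.ofReal_pos.2 (by positivity : (0 : ℝ) < 2 * π)).ne'
        ENNReal.ofReal_ne_top]⟩
  refine (Measure.pi_eq fun s _ => ?_)
  rw [Measure.smul_apply, smul_eq_mul, Measure.pi_pi]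
  simp only [Measure.smul_apply, smul_eq_mul]
  rw [prod_mul_distrib, prod_const, card_univ, one_div,
    ENNReal.ofReal_pow (by positivity), ENNReal.ofReal_inv_of_pos (by positivity : (0 : ℝ) < 2 * π)]

/-- `∫ e^{t cos θ} (2π)⁻¹dθ = I₀(t)`: the moment generating function of `cos θ` under the one-angle
Haar probability is the modified Bessel function (row 5's `onePlaquetteZ_eq_besselI`). [ours] -/
theorem mgf_cos_u1Haar_eq_besselI (t : ℝ) :
    mgf (fun θ => Real.cos θ) ((ENNReal.ofReal (2 * π))⁻¹ • volume.restrict (Ioc (0 : ℝ) (2 * π))) t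
      = besselI 0 t := by
  have h2π : (0 : ℝ) ≤ 2 * π := by positivity
  have hc : ((ENNReal.ofReal (2 * π))⁻¹).toReal = 1 / (2 * π) := by
    rw [ENNReal.toReal_inv, ENNReal.toReal_ofReal h2π, one_div]
  rw [mgf, integral_smul_measure, smul_eq_mul, hc, ← intervalIntegral.integral_of_le h2π]
  change 1 / (2 * π) * onePlaquetteZ t = besselI 0 t
  rw [onePlaquetteZ_eq_besselI]
  field_simp

end Bridge

/-! ## §2 The dictionary: GEN-12's acceptance is the tilt-family functional -/

section Dictionary

variable {ι : Type*} [Fintype ι]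

/-- **THE DICTIONARY.**  GEN-12's acceptance of the untrained U(1) sampler (densities against
Lebesgue measure on `(0,2π]^V`) equals the tilt-family acceptance functional for the product Haar
probability and `T = Σᵢ cos θᵢ`:
`∫∫ min(P(x)Q(x′), P(x′)Q(x)) = (∫∫ min(e^{βT}, e^{βT′}) dHaar^{⊗V}dHaar^{⊗V}) / ∫ e^{βT} dHaar^{⊗V}`. [ours] -/
theorem u1IdentityFlow_meanAccept_eq_tilt (β : ℝ) :
    ∫ x, ∫ x', min ((∏ i : ι, Real.exp (β * Real.cos (x i)) / onePlaquetteZ β)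
          * ∏ _i : ι, (1 / (2 * π) : ℝ))
        ((∏ i : ι, Real.exp (β * Real.cos (x' i)) / onePlaquetteZ β) * ∏ _i : ι, (1 / (2 * π) : ℝ))
        ∂(Measure.pi fun _ : ι => volume.restrict (Ioc (0 : ℝ) (2 * π)))
        ∂(Measure.pi fun _ : ι => volume.restrict (Ioc (0 : ℝ) (2 * π)))
      = (∫ x, ∫ x', min (Real.exp (β * ∑ i, Real.cos (x i))) (Real.exp (β * ∑ i, Real.cos (x' i)))
            ∂(Measure.pi fun _ : ι => (ENNReal.ofReal (2 * π))⁻¹ • volume.restrict (Ioc (0 : ℝ) (2 * π)))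
            ∂(Measure.pi fun _ : ι => (ENNReal.ofReal (2 * π))⁻¹ • volume.restrict (Ioc (0 : ℝ) (2 * π))))
          / ∫ x, Real.exp (β * ∑ i, Real.cos (x i))
            ∂(Measure.pi fun _ : ι => (ENNReal.ofReal (2 * π))⁻¹ • volume.restrict (Ioc (0 : ℝ) (2 * π))) := by
  haveI : IsProbabilityMeasure ((ENNReal.ofReal (2 * π))⁻¹ • volume.restrict (Ioc (0 : ℝ) (2 * π))) :=
    ⟨by rw [Measure.smul_apply, Measure.restrict_apply_univ, Real.volume_Ioc, sub_zero, smul_eq_mul,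
      ENNReal.inv_mul_cancel (ENNReal.ofReal_pos.2 (by positivity : (0 : ℝ) < 2 * π)).ne'
        ENNReal.ofReal_ne_top]⟩
  have hZ : 0 < onePlaquetteZ β := onePlaquetteZ_pos β
  have hπ : (0 : ℝ) < 2 * π := by positivity
  -- the constant carried by the two densities
  set K : ℝ := (1 / (2 * π)) ^ Fintype.card ι / onePlaquetteZ β ^ Fintype.card ι with hK
  have hK0 : 0 ≤ K := by positivity
  have hPQ : ∀ x : ι → ℝ,
      (∏ i : ι, Real.exp (β * Real.cos (x i)) / onePlaquetteZ β) * ∏ _i : ι, (1 / (2 * π) : ℝ)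
        = Real.exp (β * ∑ i, Real.cos (x i)) * K := fun x => by
    rw [prod_div_distrib, ← Real.exp_sum, ← mul_sum, prod_const, card_univ, prod_const, card_univ, hK]
    field_simp
  have hmin : ∀ x x' : ι → ℝ,
      min ((∏ i : ι, Real.exp (β * Real.cos (x i)) / onePlaquetteZ β) * ∏ _i : ι, (1 / (2 * π) : ℝ))
          ((∏ i : ι, Real.exp (β * Real.cos (x' i)) / onePlaquetteZ β) * ∏ _i : ι, (1 / (2 * π) : ℝ))
        = min (Real.exp (β * ∑ i, Real.cos (x i))) (Real.exp (β * ∑ i, Real.cos (x' i))) * K :=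
    fun x x' => by rw [hPQ x, hPQ x', min_mul_of_nonneg _ _ hK0]
  -- left-hand side `= (∫∫ min(e^{βT}, e^{βT′}) dLeb^{⊗V} dLeb^{⊗V}) · K`
  have hL : ∫ x, ∫ x', min ((∏ i : ι, Real.exp (β * Real.cos (x i)) / onePlaquetteZ β)
          * ∏ _i : ι, (1 / (2 * π) : ℝ))
        ((∏ i : ι, Real.exp (β * Real.cos (x' i)) / onePlaquetteZ β) * ∏ _i : ι, (1 / (2 * π) : ℝ))
        ∂(Measure.pi fun _ : ι => volume.restrict (Ioc (0 : ℝ) (2 * π)))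
        ∂(Measure.pi fun _ : ι => volume.restrict (Ioc (0 : ℝ) (2 * π)))
      = (∫ x, ∫ x', min (Real.exp (β * ∑ i, Real.cos (x i))) (Real.exp (β * ∑ i, Real.cos (x' i)))
          ∂(Measure.pi fun _ : ι => volume.restrict (Ioc (0 : ℝ) (2 * π)))
          ∂(Measure.pi fun _ : ι => volume.restrict (Ioc (0 : ℝ) (2 * π)))) * K := by
    rw [← integral_mul_const]
    refine integral_congr_ae (Filter.Eventually.of_forall fun x => ?_)
    simp only
    rw [← integral_mul_const]
    refine integral_congr_ae (Filter.Eventually.of_forall fun x' => ?_)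
    exact hmin x x'
  -- the normalisation constant of `Haar^{⊗V}` against `Leb^{⊗V}`
  have hc : (ENNReal.ofReal ((1 / (2 * π)) ^ Fintype.card ι)).toReal = (1 / (2 * π)) ^ Fintype.card ι :=
    ENNReal.toReal_ofReal (by positivity)
  -- numerator in the Lebesgue normalisation
  have hN : ∫ x, ∫ x', min (Real.exp (β * ∑ i, Real.cos (x i))) (Real.exp (β * ∑ i, Real.cos (x' i)))
        ∂(Measure.pi fun _ : ι => (ENNReal.ofReal (2 * π))⁻¹ • volume.restrict (Ioc (0 : ℝ) (2 * π)))
        ∂(Measure.pi fun _ : ι => (ENNReal.ofReal (2 * π))⁻¹ • volume.restrict (Ioc (0 : ℝ) (2 * π)))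
      = (1 / (2 * π)) ^ Fintype.card ι * ((1 / (2 * π)) ^ Fintype.card ι
        * ∫ x, ∫ x', min (Real.exp (β * ∑ i, Real.cos (x i))) (Real.exp (β * ∑ i, Real.cos (x' i)))
          ∂(Measure.pi fun _ : ι => volume.restrict (Ioc (0 : ℝ) (2 * π)))
          ∂(Measure.pi fun _ : ι => volume.restrict (Ioc (0 : ℝ) (2 * π)))) := by
    rw [u1Haar_pi_eq_smul_pi]
    simp_rw [integral_smul_measure, smul_eq_mul, hc]
    rw [integral_const_mul]
  -- denominator: `∫ e^{βT} dHaar^{⊗V} = (1/(2π))^V · Z(β)^V`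
  have hD : ∫ x, Real.exp (β * ∑ i, Real.cos (x i))
        ∂(Measure.pi fun _ : ι => (ENNReal.ofReal (2 * π))⁻¹ • volume.restrict (Ioc (0 : ℝ) (2 * π)))
      = (1 / (2 * π)) ^ Fintype.card ι * onePlaquetteZ β ^ Fintype.card ι := by
    rw [u1Haar_pi_eq_smul_pi, integral_smul_measure, smul_eq_mul, hc]
    congr 1
    have e : ∀ x : ι → ℝ, Real.exp (β * ∑ i, Real.cos (x i)) = ∏ i, Real.exp (β * Real.cos (x i)) :=
      fun x => by rw [mul_sum, Real.exp_sum]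
    simp_rw [e]
    rw [integral_fintype_prod_eq_prod (𝕜 := ℝ) (fun (_ : ι) (θ : ℝ) => Real.exp (β * Real.cos θ)),
      prod_const, card_univ, integral_Ioc_exp_mul_cos]
  rw [hL, hN, hD, hK]
  field_simp

end Dictionary

/-! ## §3 The diagonal `β√V = c` in the closed-form vocabulary -/

section DiagonalLaws

/-- **`ESS_V(c/√V) → e^{−c²/2}`**: GEN-12's exact ESS fraction `(I₀(β)²/I₀(2β))^V` of the untrained
U(1) sampler, read at `β = c/√V`, converges to the log-normal model's `e^{−s}`, `s = c²/2`. [ours] -/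
theorem u1IdentityFlow_essFrac_diag_tendsto (c : ℝ) :
    Tendsto (fun V : ℕ => (besselI 0 (c / Real.sqrt V) ^ 2 / besselI 0 (2 * c / Real.sqrt V)) ^ V)
      atTop (𝓝 (Real.exp (-(c ^ 2 / 2)))) := by
  haveI : IsProbabilityMeasure ((ENNReal.ofReal (2 * π))⁻¹ • volume.restrict (Ioc (0 : ℝ) (2 * π))) :=
    ⟨by rw [Measure.smul_apply, Measure.restrict_apply_univ, Real.volume_Ioc, sub_zero, smul_eq_mul,
      ENNReal.inv_mul_cancel (ENNReal.ofReal_pos.2 (by positivity : (0 : ℝ) < 2 * π)).ne'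
        ENNReal.ofReal_ne_top]⟩
  obtain ⟨h1, -, -⟩ := cos_uniform_moments
  have h := tendsto_essFrac_diag (μ := (ENNReal.ofReal (2 * π))⁻¹ • volume.restrict (Ioc (0 : ℝ) (2 * π)))
    (X := fun θ => Real.cos θ) (a := -1) (b := 1) Real.measurable_cos.aemeasurable
    (ae_of_all _ fun θ => ⟨Real.neg_one_le_cos θ, Real.cos_le_one θ⟩) h1 c
  rw [variance_cos_uniform, show c ^ 2 * (1 / 2 : ℝ) = c ^ 2 / 2 by ring] at h
  simp_rw [mgf_cos_u1Haar_eq_besselI] at h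
  exact h

/-- **Ceiling `(I₀(β/2)²/I₀(β))^V → e^{−c²/8}`** at `β = c/√V` (GEN-12's Bhattacharyya ceiling of
`acc_V`; the log-normal `e^{−s/4}`). [ours] -/
theorem u1IdentityFlow_ceiling_diag_tendsto (c : ℝ) :
    Tendsto (fun V : ℕ => (besselI 0 (c / 2 / Real.sqrt V) ^ 2 / besselI 0 (c / Real.sqrt V)) ^ V)
      atTop (𝓝 (Real.exp (-(c ^ 2 / 8)))) := by
  haveI : IsProbabilityMeasure ((ENNReal.ofReal (2 * π))⁻¹ • volume.restrict (Ioc (0 : ℝ) (2 * π))) :=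
    ⟨by rw [Measure.smul_apply, Measure.restrict_apply_univ, Real.volume_Ioc, sub_zero, smul_eq_mul,
      ENNReal.inv_mul_cancel (ENNReal.ofReal_pos.2 (by positivity : (0 : ℝ) < 2 * π)).ne'
        ENNReal.ofReal_ne_top]⟩
  obtain ⟨h1, -, -⟩ := cos_uniform_moments
  have h := tendsto_bhattacharyyaCeiling_diag
    (μ := (ENNReal.ofReal (2 * π))⁻¹ • volume.restrict (Ioc (0 : ℝ) (2 * π)))
    (X := fun θ => Real.cos θ) (a := -1) (b := 1) Real.measurable_cos.aemeasurable
    (ae_of_all _ fun θ => ⟨Real.neg_one_le_cos θ, Real.cos_le_one θ⟩) h1 c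
  rw [variance_cos_uniform, show c ^ 2 * (1 / 2 : ℝ) / 4 = c ^ 2 / 8 by ring] at h
  simp_rw [mgf_cos_u1Haar_eq_besselI] at h
  exact h

/-- **`acc_V(c/√V) → erfc(|c|/(2√2))` IN GEN-12's VOCABULARY**: the equilibrium acceptance
`∫∫ min(P(x)Q(x′), P(x′)Q(x))` of `Scaling/U1IdentityFlowVolumeLaw` (`V = n` plaquettes, densities
against Lebesgue measure) at `β = c/√V`, `c ≠ 0`, converges to `(2/√π)∫_{|c|/(2√2)}^∞ e^{−u²}du`.
[ours] -/
theorem u1IdentityFlow_meanAccept_diag_tendsto {c : ℝ} (hc : c ≠ 0) :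
    Tendsto (fun n : ℕ =>
        ∫ x, ∫ x', min ((∏ i : Fin n, Real.exp (c / Real.sqrt n * Real.cos (x i))
              / onePlaquetteZ (c / Real.sqrt n)) * ∏ _i : Fin n, (1 / (2 * π) : ℝ))
            ((∏ i : Fin n, Real.exp (c / Real.sqrt n * Real.cos (x' i)) / onePlaquetteZ (c / Real.sqrt n))
              * ∏ _i : Fin n, (1 / (2 * π) : ℝ))
          ∂(Measure.pi fun _ : Fin n => volume.restrict (Ioc (0 : ℝ) (2 * π)))
          ∂(Measure.pi fun _ : Fin n => volume.restrict (Ioc (0 : ℝ) (2 * π))))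
      atTop (𝓝 (2 / Real.sqrt Real.pi * ∫ u in Ioi (|c| / (2 * Real.sqrt 2)), Real.exp (-u ^ 2))) := by
  refine (u1Pi_meanAccept_diag_tendsto hc).congr fun n => ?_
  exact (u1IdentityFlow_meanAccept_eq_tilt (ι := Fin n) (c / Real.sqrt n)).symm

end DiagonalLaws

end Summit.Ventures.LatticeQCDFlow.Theory2

end
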